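import Mathlib
import HarnessLib
import Literature.Computability.AlgebraicComplexity.KabanetsImpagliazzoHardness
import Literature.Computability.AlgebraicComplexity.ValiantConjectureEquivProofs
import Summits.ValiantsHypothesis.ValiantsHypothesis.Theorems.DefinabilityGapAffineRung
import Summits.ValiantsHypothesis.ValiantsHypothesis.Theorems.DefinabilityGapWeakToK1ws

/-!
# DefinabilityGap — K1 is NECESSARY: Valiant's hypothesis ⟹ the planted KI-permanent map hits `VP` i.o.
# (support for `KIPlantedHitting`, item `stmt-ValiantsHypothesis-23547`; unconditional kernel)

Route `route-ValiantsHypothesis-DefinabilityGap` decides `VP_ℂ ≠ VNP_ℂ` from K1 (`KIPlantedHitting`: for every level `b` and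
cofinally many `m`, no nonzero `D` of circuit size and degree `≤ q(m)^b` annihilates the planted Kabanets–Impagliazzo map
`G_m = kiPer m`, coordinate `c ↦ per_m(y|_{S_c})` on the quadratic-curve design) and K2c. THIS FILE proves the converse
direction for K1, unconditionally and by kernel: the tree's PROVED hardness-to-hitting engine
(`kiGenerator_isHittingSetGenerator`: KI 2003 Lemma 30 / Thm 7.7 with the root-lifting bound, KRST Lemma 8) on the design
`quadDesign_isNWDesign` gives

* `kiPer_hits_of_perm_hard` — for every `b` a threshold exponent `c` such that AT EVERY `m` with `L(per_m) > m^c + c` the map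
  `G_m` hits every nonzero `D` with `L(D) ≤ q(m)^b`, `deg D ≤ q(m)^b` (pointwise, hypothesis-free);
* `kiPlantedHitting_of_VP_ne_VNP` — `VP_ℂ ≠ VNP_ℂ` ⟹ the statement of K1 verbatim (in the `qOf`/`kiPer` spelling of
  `DefinabilityGapAffineRung`, definitionally the route's inline term), via `PER ∈ VP ↔ VP = VNP` (von zur Gathen 1987 Prop. 4.8,
  tree `isPComputable_perPoly_complex_iff`) and the finite-maximum argument `exists_large_of_not_isPBounded`;
* `VP_eq_VNP_of_not_kiPlantedHitting` — the dichotomy reading: either the explicit generator works, or `VP_ℂ = VNP_ℂ`.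

CONSEQUENCES FOR THE ROUTE (honest): (i) K1 is a CONSEQUENCE of the summit — refuting K1 would refute Valiant's hypothesis
itself, so K1 carries no misstatement risk and is certifiably on-path (`S → K1`); (ii) with `closes : K1 → K2c → S` and the
vacuous `S → K2c`, the route is an EXACT conjunct split `VP_ℂ ≠ VNP_ℂ ⟺ K1 ∧ K2c`, and after rung 4 /
`DefinabilityGapCollapseLiftIff` equally `⟺ K1 ∧ (VP ≠ VPSPACE⁰_b ⟹ VP ≠ VNP)`; (iii) nothing here bears on whether K1 is
PROVABLE without proving `VP ≠ VNP` first — K1 remains exactly as hard as an explicit lower bound (KI 2003 Thm 7.7/7.8).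
No route file is imported; no item is concluded by name.

## References

* [KabanetsImpagliazzo2003] V. Kabanets, R. Impagliazzo, *Derandomizing polynomial identity tests means proving circuit
  lower bounds*, STOC 2003 / comput. complexity 13 (2004), Lemma 30, Thm. 7.7.
* [KumarRamyaSaptharishiTengse2022] M. Kumar, C. Ramya, R. Saptharishi, A. Tengse, *If VNP is hard, then so are equations
  for it*, STACS 2022, Lemma 8, §3.4–3.5.
* [Vonzurgathen1987Feasible] J. von zur Gathen, *Feasible arithmetic computations: Valiant's hypothesis*, JSC 4 (1987), Prop. 4.8.
* [Burgisser2000] P. Bürgisser, *Completeness and Reduction in Algebraic Complexity Theory*, Springer 2000, Rem. 2.11, Thm. 2.10.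
-/

noncomputable section

open MvPolynomial
open Literature.Computability.AlgebraicComplexity

namespace Summit.ValiantsHypothesis.ValiantsHypothesis.Theorems.DefinabilityGapK1Necessary

open DefinabilityGapAffineRung DefinabilityGapWeakToK1ws

/-- **Pointwise hardness ⟹ hitting for the planted map (unconditional).** For every level `b` there is `c` such that at
every `m` where the permanent is hard, `L(per_m) > m^c + c`, the planted KI map `G_m` hits every nonzero `D` in `q(m)³`
variables with `L(D) ≤ q(m)^b` and `deg D ≤ q(m)^b`. (Tree engine `kiGenerator_isHittingSetGenerator` on the quadratic-curve
design, `quadDesign_isNWDesign`, with `f = Perm_[q]`, `L(Perm_[q]) = L(per_m)`, `deg ≤ m`.)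
[cite: KabanetsImpagliazzo2003, Lemma 30; KumarRamyaSaptharishiTengse2022, Lemma 8] -/
theorem kiPer_hits_of_perm_hard (b : ℕ) : ∃ c : ℕ, ∀ m : ℕ, m ^ c + c < complexity (perPoly (Fin m) ℂ) →
    ∀ D : MvPolynomial (Fin 3 → Fin (qOf m)) ℂ, D ≠ 0 → complexity D ≤ qOf m ^ b →
      D.totalDegree ≤ qOf m ^ b → bind₁ (kiPer m) D ≠ 0 := by
  -- the level-`b` KI threshold is p-bounded in `m` (the same polynomial as `DefinabilityGapWsSplit.isPBounded_kiThreshold`,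
  -- recomputed locally to keep this file independent of the route file)
  obtain ⟨c, hc⟩ : IsPBounded fun m =>
      (qOf m ^ b + qOf m ^ 3 * ((m + 1) ^ 2 * (2 * m + 2)) + qOf m ^ b * (m + 1) + m + qOf m + 4) ^ 7 := by
    have hq : IsPBounded qOf := isPBounded_qOf
    have hqb : IsPBounded fun m => qOf m ^ b := IsPBounded.pow_holds hq b
    have hm1 : IsPBounded fun m => m + 1 := IsPBounded.add_holds IsPBounded.id (IsPBounded.const 1)
    have h1 : IsPBounded fun m => qOf m ^ 3 * ((m + 1) ^ 2 * (2 * m + 2)) :=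
      IsPBounded.mul_holds (IsPBounded.pow_holds hq 3)
        (IsPBounded.mul_holds (IsPBounded.pow_holds hm1 2)
          (IsPBounded.add_holds (IsPBounded.mul_holds (IsPBounded.const 2) IsPBounded.id) (IsPBounded.const 2)))
    have h2 : IsPBounded fun m => qOf m ^ b * (m + 1) := IsPBounded.mul_holds hqb hm1
    exact IsPBounded.pow_holds (IsPBounded.add_holds (IsPBounded.add_holds (IsPBounded.add_holds
      (IsPBounded.add_holds (IsPBounded.add_holds hqb h1) h2) IsPBounded.id) hq) (IsPBounded.const 4)) 7
  refine ⟨c, fun m hm D hD hs hΔ => ?_⟩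
  have hdeg : (perPad ℂ (sq_le_qOf m)).totalDegree ≤ m := totalDegree_perPad_le _
  have hcard : Fintype.card (Fin 3 → Fin (qOf m)) = qOf m ^ 3 := by simp
  have hmax : max 1 (perPad ℂ (sq_le_qOf m)).totalDegree ≤ m + 1 := by omega
  refine kiGenerator_isHittingSetGenerator (quadDesign_isNWDesign m) (perPad ℂ (sq_le_qOf m))
    (s := qOf m ^ b) (Δ := qOf m ^ b) ?_ hs hΔ hD
  have hT := hc m
  dsimp only at hT
  calc (qOf m ^ b + Fintype.card (Fin 3 → Fin (qOf m)) *
          (((perPad ℂ (sq_le_qOf m)).totalDegree + 1) ^ 2 * (2 * (perPad ℂ (sq_le_qOf m)).totalDegree + 2)) +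
          qOf m ^ b * max 1 (perPad ℂ (sq_le_qOf m)).totalDegree + (perPad ℂ (sq_le_qOf m)).totalDegree +
          Fintype.card (Fin (qOf m)) + 4) ^ 7
      ≤ (qOf m ^ b + qOf m ^ 3 * ((m + 1) ^ 2 * (2 * m + 2)) + qOf m ^ b * (m + 1) + m + qOf m + 4) ^ 7 := by
        rw [hcard, Fintype.card_fin]; gcongr
    _ ≤ m ^ c + c := hT
    _ < complexity (perPoly (Fin m) ℂ) := hm
    _ = complexity (perPad ℂ (sq_le_qOf m)) := (complexity_perPad (sq_le_qOf m)).symm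

/-- **Valiant's hypothesis ⟹ K1.** If `VP_ℂ ≠ VNP_ℂ` then for every `b, m₀` there is `m ≥ m₀` at which the planted KI map
`G_m` hits every nonzero `D` with `L(D) ≤ q(m)^b`, `deg D ≤ q(m)^b` — verbatim the statement of crux K1 `KIPlantedHitting`
(in the `qOf`/`kiPer` spelling). So K1 is NECESSARY for the summit: `VP_ℂ ≠ VNP_ℂ ⟺ K1 ∧ K2c` is an exact conjunct split.
(`VP ≠ VNP ⟹ per ∉ VP` by `PER ∈ VP ↔ VP = VNP`; non-p-boundedness beats every threshold at arbitrarily large `m`.)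
[cite: KabanetsImpagliazzo2003, Thm. 7.7; Vonzurgathen1987Feasible, Prop. 4.8; Burgisser2000, Rem. 2.11] -/
theorem kiPlantedHitting_of_VP_ne_VNP (hV : VP ℂ ≠ VNP ℂ) :
    ∀ b m₀ : ℕ, ∃ m, m₀ ≤ m ∧ ∀ D : MvPolynomial (Fin 3 → Fin (qOf m)) ℂ, D ≠ 0 →
      complexity D ≤ qOf m ^ b → D.totalDegree ≤ qOf m ^ b → bind₁ (kiPer m) D ≠ 0 := by
  intro b m₀
  have hnp : ¬ IsPBounded (fun n => complexity (perPoly (Fin n) ℂ)) :=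
    fun h => hV (isPComputable_perPoly_complex_iff.1 h)
  obtain ⟨c, hc⟩ := kiPer_hits_of_perm_hard b
  obtain ⟨m, hm, hlt⟩ := exists_large_of_not_isPBounded hnp c m₀
  exact ⟨m, hm, hc m hlt⟩

/-- **Dichotomy reading**: if K1 fails — some level `b` and cofinitely many `m` admit a nonzero small low-degree annihilator of
`G_m` — then `VP_ℂ = VNP_ℂ`. Either the explicit generator works, or Valiant's classes collapse.
[cite: KabanetsImpagliazzo2003, Thm. 7.7; Vonzurgathen1987Feasible, Prop. 4.8] -/
theorem VP_eq_VNP_of_not_kiPlantedHitting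
    (hK : ¬ ∀ b m₀ : ℕ, ∃ m, m₀ ≤ m ∧ ∀ D : MvPolynomial (Fin 3 → Fin (qOf m)) ℂ, D ≠ 0 →
      complexity D ≤ qOf m ^ b → D.totalDegree ≤ qOf m ^ b → bind₁ (kiPer m) D ≠ 0) :
    VP ℂ = VNP ℂ := by
  by_contra hV
  exact hK (kiPlantedHitting_of_VP_ne_VNP hV)

/-- **Pointwise converse bookkeeping**: at every `m`, if SOME nonzero `D` with `L(D), deg D ≤ q(m)^b` annihilates `G_m`, then
`L(per_m) ≤ m^c + c` for the threshold exponent `c = c(b)` of `kiPer_hits_of_perm_hard` — an explicit circuit UPPER bound for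
the permanent extracted from an annihilator (KI's "derandomization ⟹ lower bounds" in reverse gear).
[cite: KabanetsImpagliazzo2003, Lemma 30] -/
theorem complexity_perm_le_of_annihilator (b : ℕ) : ∃ c : ℕ, ∀ m : ℕ,
    (∃ D : MvPolynomial (Fin 3 → Fin (qOf m)) ℂ, D ≠ 0 ∧ complexity D ≤ qOf m ^ b ∧
      D.totalDegree ≤ qOf m ^ b ∧ bind₁ (kiPer m) D = 0) → complexity (perPoly (Fin m) ℂ) ≤ m ^ c + c := by
  obtain ⟨c, hc⟩ := kiPer_hits_of_perm_hard b
  refine ⟨c, fun m ⟨D, hD, hs, hΔ, hann⟩ => ?_⟩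
  by_contra hlt
  exact hc m (by omega) D hD hs hΔ hann

end Summit.ValiantsHypothesis.ValiantsHypothesis.Theorems.DefinabilityGapK1Necessary

end
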